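import Literature.Probability.LatticeModels.DirichletGreenFunction
import Literature.Probability.LatticeModels.DiluteLoopModelSAW
import Literature.Probability.RandomPlanarGeometry.SAWScalingLimitFamily

/-!
# Stub `stub_kernelScalingLimit`, input (E2): strict positivity of the Dirichlet Green function
# along lattice paths (line `excursion-kernel-covariance`, crux `RectilinearCardy`,
# stmt-CriticalPhenomena-5660)

The cube-root weight `W(v) = (K_δ(v,a_δ) K_δ(v,b_δ) K_δ(v,d_δ))^{1/3}` of the line is built from the
tree's Dirichlet Green function `K_δ = dirichletGreen Ω_δ` (`Literature.Probability.LatticeModels.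
dirichletGreen`, the Green function of simple random walk killed on leaving the finite set). Part (b)
of the stub (`0 < kernelMass R δ (mark 1)` eventually) needs STRICT positivity of `K_δ` between
vertices joined inside `Ω_δ`; the tree only has `dirichletGreen_nonneg`. This file proves, in every
dimension `d ≥ 1`:

* `dirichletGreen_le_two_mul_d_mul_of_adj` — the one-step Harnack inequality
  `G_Λ(x,w) ≤ 2d · G_Λ(x,y)` for `y ∈ Λ` and `w ∼ y` (the Poisson equation at `y` plus `G_Λ ≥ 0`);
* `dirichletGreen_diag_pos_of_mem` — `0 < G_Λ(x,x)` on `Λ`;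
* `dirichletGreen_pos_of_walk` — `0 < G_Λ(x,y)` whenever `x` and `y` are joined by a
  nearest-neighbour path all of whose vertices lie in `Λ` (induction along the path);
* `dirichletGreen_pos_of_walk_le`, `dirichletGreen_pos_of_reachable` — the same for walks of a
  subgraph of `ℤ^d` and for reachability in the graph induced by `ℤ^d` on `Λ`;
* `dirichletGreen_meshDomain_pos_of_reachable`, `dirichletGreen_meshDomain_pos_of_meshReachable` —
  the planar specialisation to H21's discrete domain `Ω_δ = meshDomain Ω δ`: two vertices of `Ω_δ`
  joined in `discreteDomainGraph Ω δ`, or in the mesh graph on mesh vertices (the conclusion of the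
  tree's `JordanDomain.exists_forall_mem_meshDomain_and_reachable`), have `0 < dirichletGreen Ω_δ u v`
  (walks of `Ω_δ` stay in `Ω_δ`: tree lemmas `DiluteLoopModel.support_subset_meshDomain`,
  `reachable_discreteDomainGraph_of_walk`).

All statements are folklore (Lawler 1991, §1.4–1.5: `G_A(x,y) > 0` iff `y` can be reached from `x`
inside `A`).
-/

noncomputable section

namespace Summit.CriticalPhenomena.CardyFormulaZ2.Cruxes.RectilinearCardy.ExcursionKernelCovariance

open Literature.Probability.LatticeModels

/-! ### One-step Harnack inequality and the diagonal -/

/-- **One-step Harnack inequality for the Dirichlet Green function** (`d ≥ 1`): for `y ∈ Λ` and a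
lattice neighbour `w ∼ y`, `G_Λ(x,w) ≤ 2d · G_Λ(x,y)` — the Poisson equation
`2d G_Λ(x,y) = [x = y] + ∑_{w' ∼ y} G_Λ(x,w')` at `y` and `G_Λ ≥ 0`. [folklore] -/
theorem dirichletGreen_le_two_mul_d_mul_of_adj {d : ℕ} (hd : 0 < d) (Λ : Finset (Site d)) (x : Site d)
    {y w : Site d} (hy : y ∈ Λ) (hw : (zdGraph d).Adj y w) :
    dirichletGreen Λ x w ≤ 2 * d * dirichletGreen Λ x y := by
  have h := sum_neighborFinset_dirichletGreen hd Λ x hy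
  have hmem : w ∈ (zdGraph d).neighborFinset y := (SimpleGraph.mem_neighborFinset _ _ _).2 hw
  have h1 : dirichletGreen Λ x w ≤ ∑ w' ∈ (zdGraph d).neighborFinset y, dirichletGreen Λ x w' :=
    Finset.single_le_sum (fun w' _ => dirichletGreen_nonneg hd Λ x w') hmem
  have h2 : (0 : ℝ) ≤ if x = y then 1 else 0 := by split_ifs <;> norm_num
  linarith

/-- **The diagonal of the Dirichlet Green function is positive on `Λ`** (`d ≥ 1`): the Poisson
equation at `x` reads `2d G_Λ(x,x) = 1 + ∑_{w ∼ x} G_Λ(x,w) ≥ 1`. [folklore] -/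
theorem dirichletGreen_diag_pos_of_mem {d : ℕ} (hd : 0 < d) (Λ : Finset (Site d)) {x : Site d}
    (hx : x ∈ Λ) : 0 < dirichletGreen Λ x x := by
  have h := sum_neighborFinset_dirichletGreen hd Λ x hx
  rw [if_pos rfl] at h
  have hs : 0 ≤ ∑ w ∈ (zdGraph d).neighborFinset x, dirichletGreen Λ x w :=
    Finset.sum_nonneg fun w _ => dirichletGreen_nonneg hd Λ x w
  have hd' : (0 : ℝ) < 2 * (d : ℝ) := by positivity
  nlinarith

/-! ### Positivity along lattice paths inside `Λ` -/

/-- **The Dirichlet Green function is positive along lattice paths inside `Λ`** (`d ≥ 1`): if `x`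
and `y` are joined by a nearest-neighbour walk of `ℤ^d` all of whose vertices lie in `Λ`, then
`0 < G_Λ(x,y)` (positivity propagates from the diagonal one step at a time by the Harnack
inequality `G_Λ(w,y) ≤ 2d G_Λ(x,y)` for `w ∼ x`, `x ∈ Λ`). [folklore] -/
theorem dirichletGreen_pos_of_walk {d : ℕ} (hd : 0 < d) (Λ : Finset (Site d)) {x y : Site d}
    (p : (zdGraph d).Walk x y) (hp : ∀ v ∈ p.support, v ∈ Λ) : 0 < dirichletGreen Λ x y := by
  induction p with
  | nil =>
    exact dirichletGreen_diag_pos_of_mem hd Λ (hp _ (SimpleGraph.Walk.start_mem_support _))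
  | @cons u v w huv p ih =>
    have hu : u ∈ Λ := hp u (SimpleGraph.Walk.start_mem_support _)
    have hvw : 0 < dirichletGreen Λ v w :=
      ih fun z hz => hp z (by rw [SimpleGraph.Walk.support_cons]; exact List.mem_cons_of_mem u hz)
    have hle : dirichletGreen Λ w v ≤ 2 * d * dirichletGreen Λ w u :=
      dirichletGreen_le_two_mul_d_mul_of_adj hd Λ w hu huv
    rw [dirichletGreen_comm Λ v w] at hvw
    rw [dirichletGreen_comm Λ u w]
    have hd' : (0 : ℝ) < 2 * (d : ℝ) := by positivity
    exact pos_of_mul_pos_right (lt_of_lt_of_le hvw hle) hd'.le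

/-- Positivity of `G_Λ` along a walk of any subgraph `G ≤ ℤ^d` whose vertices lie in `Λ`.
[folklore] -/
theorem dirichletGreen_pos_of_walk_le {d : ℕ} (hd : 0 < d) (Λ : Finset (Site d))
    {G : SimpleGraph (Site d)} (hG : G ≤ zdGraph d) {x y : Site d} (p : G.Walk x y)
    (hp : ∀ v ∈ p.support, v ∈ Λ) : 0 < dirichletGreen Λ x y :=
  dirichletGreen_pos_of_walk hd Λ (p.mapLe hG)
    (by rw [SimpleGraph.Walk.support_mapLe_eq_support]; exact hp)

/-- **`G_Λ(x,y) > 0` for `x, y` in the same connected component of `Λ`** (`d ≥ 1`): reachability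
in the graph induced by `ℤ^d` on `Λ` gives `0 < G_Λ(x,y)`. [folklore] -/
theorem dirichletGreen_pos_of_reachable {d : ℕ} (hd : 0 < d) (Λ : Finset (Site d)) {x y : Site d}
    (hx : x ∈ Λ) (hy : y ∈ Λ)
    (h : ((zdGraph d).induce (↑Λ : Set (Site d))).Reachable ⟨x, hx⟩ ⟨y, hy⟩) :
    0 < dirichletGreen Λ x y := by
  obtain ⟨p⟩ := h
  have key := dirichletGreen_pos_of_walk hd Λ
    (p.map (SimpleGraph.Embedding.induce (↑Λ : Set (Site d))).toHom) (by
      intro v hv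
      rw [SimpleGraph.Walk.support_map, List.mem_map] at hv
      obtain ⟨w, -, rfl⟩ := hv
      exact w.2)
  exact key

/-! ### The planar discrete domain `Ω_δ` -/

/-- **Positivity of the excursion kernel of the lattice polygon**: for a bounded `Ω`, `δ > 0`,
a vertex `u` of the discrete domain `Ω_δ = meshDomain Ω δ` and a vertex `v` joined to `u` in
`discreteDomainGraph Ω δ`, the Dirichlet Green function of `Ω_δ` satisfies `0 < G_{Ω_δ}(u,v)`.
[folklore] -/
theorem dirichletGreen_meshDomain_pos_of_reachable {Ω : Set ℂ} {δ : ℝ}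
    (hΩ : Bornology.IsBounded Ω) (hδ : 0 < δ) {u v : Site 2} (hu : u ∈ meshDomain Ω δ)
    (h : (discreteDomainGraph Ω δ).Reachable u v) :
    0 < dirichletGreen (meshDomain_finite hΩ hδ).toFinset u v := by
  obtain ⟨p⟩ := h
  refine dirichletGreen_pos_of_walk_le (by norm_num) _
    ((discreteDomainGraph_le_meshGraph Ω δ).trans (meshGraph_le_zdGraph Ω δ)) p ?_
  intro w hw
  rw [Set.Finite.mem_toFinset]
  exact DiluteLoopModel.support_subset_meshDomain p hu w hw

/-- **Positivity of the excursion kernel, mesh-graph form**: for a bounded `Ω`, `δ > 0`, a vertex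
`u ∈ meshDomain Ω δ` and a mesh vertex `v` reachable from `u` in the mesh graph on mesh vertices
(the conclusion of the tree's `JordanDomain.exists_forall_mem_meshDomain_and_reachable`),
`0 < G_{Ω_δ}(u,v)`. [folklore] -/
theorem dirichletGreen_meshDomain_pos_of_meshReachable {Ω : Set ℂ} {δ : ℝ}
    (hΩ : Bornology.IsBounded Ω) (hδ : 0 < δ) {u v : Site 2} (hu : u ∈ meshDomain Ω δ)
    {hu' : u ∈ meshVertices Ω δ} {hv' : v ∈ meshVertices Ω δ}
    (h : (meshVertexGraph Ω δ).Reachable ⟨u, hu'⟩ ⟨v, hv'⟩) :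
    0 < dirichletGreen (meshDomain_finite hΩ hδ).toFinset u v := by
  obtain ⟨p⟩ := h
  exact dirichletGreen_meshDomain_pos_of_reachable hΩ hδ hu
    (Literature.Probability.RandomPlanarGeometry.reachable_discreteDomainGraph_of_walk p hu)

end Summit.CriticalPhenomena.CardyFormulaZ2.Cruxes.RectilinearCardy.ExcursionKernelCovariance
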